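import Literature.Analysis.Matrix.SchoenbergKernelsProofs
import Mathlib.Analysis.Matrix.Order
import Mathlib.Analysis.SpecialFunctions.ContinuousFunctionalCalculus.Rpow.Basic
import HarnessLib

/-!
# The exponential kernel `e^{-c|x-y|}` is positive definite; unit Gram vectors

Topic `Literature/Analysis/Matrix`, next to `SchoenbergKernels*.lean` (BCR Ch. 3 kernels).

* **`isPosDefKernel_exp_neg_mul_abs_sub`** — for `c ≥ 0` the kernel `(x, y) ↦ e^{-c|x-y|}` on
  `ℝ` is positive definite (BCR Def. 3.1.1: every finite matrix `(e^{-c|x_j-x_k|})_{jk}` is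
  positive semidefinite). Classical (it is the characteristic function of a Cauchy law; Pólya's
  criterion; the covariance of the stationary Ornstein–Uhlenbeck process). ELEMENTARY PROOF by
  induction on the number of points, peeling a maximal one `x₀ ≥ x_m ≥ x_k`: the new row is
  `e^{-c(x₀-x_k)} = ρ · e^{-c(x_m-x_k)}` with `ρ = e^{-c(x₀-x_m)} ≤ 1`, i.e. `ρ` times the row of
  the old maximum `m`, and `Q(v) ≥ ((Kv)_m)²` (the old matrix is positive semidefinite with unit
  diagonal) gives `Q(v) + 2v₀ρ(Kv)_m + v₀² ≥ ((Kv)_m + ρv₀)² + v₀²(1-ρ²) ≥ 0`.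
* `IsPosDefKernel.comp` — pull-back of a positive definite kernel along any map.
* `IsPosDefKernel.posSemidef_matrix_of_fintype` — the Gram-type matrix on any finite index type.
* **`IsPosDefKernel.exists_gram_vectors`** — a positive definite kernel with `φ(x,x) = 1` admits, on
  every finite family, UNIT Gram vectors in `ℂ^ι`: `Σ_r conj(X_a r) X_b r = φ(x_a, x_b)`,
  `Σ_r ‖X_a r‖² = 1` (the columns of the positive square root `CFC.sqrt` of the matrix).

Everything is PROVED; no definition. Used by
`MathematicalPhysics/QuantumLattice/MatsubaraDeterminantBound.lean` (Pedra–Salmhofer's Gram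
representation of the time kernels `e^{-|ε|·|τ-τ'|}` of the free fermionic propagator).

## References

* C. Berg, J. P. R. Christensen, P. Ressel, *Harmonic Analysis on Semigroups*, GTM 100 (1984),
  Ch. 3 §1–§2. [BergChristensenRessel1984]
* W. de Siqueira Pedra, M. Salmhofer, Comm. Math. Phys. 282 (2008) 797–818, Lemma 4.1 (the
  `L²(ℝ)` Gram representation `e^{-ετ} = ∫ e^{isτ} |Φ(s,ε)|² ds`, `τ ≥ 0`). [PedraSalmhofer2008]
-/

noncomputable section

open Finset
open scoped MatrixOrder ComplexOrder

namespace Literature.Analysis.Matrix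

variable {X : Type*}

/-- **Pull-back**: if `φ` is a positive definite kernel on `Y` and `g : X → Y`, then
`(x, x') ↦ φ (g x) (g x')` is a positive definite kernel on `X` (finite families of `X` map to
finite families of `Y`). [cite: BergChristensenRessel1984, Ch. 3 §1.1 (PDF p. 68)] -/
theorem IsPosDefKernel.comp {Y : Type*} {φ : Y → Y → ℝ} (h : IsPosDefKernel φ) (g : X → Y) :
    IsPosDefKernel fun x x' => φ (g x) (g x') :=
  ⟨fun x y => h.1 (g x) (g y), fun n x c => h.2 n (g ∘ x) c⟩

/-- The Gram-type matrix of a positive definite kernel on a family indexed by ANY finite type is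
positive semidefinite (reindex `IsPosDefKernel.posSemidef_matrix` along `Fintype.equivFin`).
[cite: BergChristensenRessel1984, Ch. 3 §1.2 (PDF p. 69)] -/
theorem IsPosDefKernel.posSemidef_matrix_of_fintype {φ : X → X → ℝ} (h : IsPosDefKernel φ)
    {ι : Type*} [Fintype ι] [DecidableEq ι] (x : ι → X) :
    (Matrix.of fun j k : ι => φ (x j) (x k)).PosSemidef := by
  set e := Fintype.equivFin ι with he
  have hP := h.posSemidef_matrix (x ∘ e.symm)
  have hsub := hP.submatrix e
  have : (Matrix.of fun j k : Fin (Fintype.card ι) => φ ((x ∘ e.symm) j) ((x ∘ e.symm) k)).submatrix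
      e e = Matrix.of fun j k : ι => φ (x j) (x k) := by
    ext j k
    simp
  rwa [this] at hsub

/-- Quadratic-form bookkeeping: for a symmetric kernel matrix `K` with `K m m = 1`,
`Q(v + t e_m) = Q(v) + 2t (Kv)_m + t²`. [folklore] -/
theorem sum_sum_mul_mul_add_single {n : ℕ} (K : Fin n → Fin n → ℝ) (hK : ∀ j k, K j k = K k j)
    (m : Fin n) (hKm : K m m = 1) (v : Fin n → ℝ) (t : ℝ) :
    ∑ j, ∑ k, (v j + if j = m then t else 0) * (v k + if k = m then t else 0) * K j k =
      ∑ j, ∑ k, v j * v k * K j k + 2 * t * ∑ k, K m k * v k + t ^ 2 := by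
  have expand : ∀ j k, (v j + if j = m then t else 0) * (v k + if k = m then t else 0) * K j k =
      v j * v k * K j k + (t * ((if j = m then (1 : ℝ) else 0) * (v k * K j k)) +
        (t * ((if k = m then (1 : ℝ) else 0) * (v j * K j k)) +
          t ^ 2 * ((if j = m then (1 : ℝ) else 0) * (if k = m then (1 : ℝ) else 0) * K j k))) := by
    intro j k
    split_ifs <;> ring
  simp_rw [expand, Finset.sum_add_distrib, ← Finset.mul_sum]
  simp only [ite_mul, one_mul, zero_mul, Finset.sum_ite_eq', Finset.mem_univ, if_true]
  have h3 : ∑ x, ∑ y, (if x = m then if y = m then K x y else 0 else 0) = 1 := by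
    rw [Finset.sum_eq_single m (fun x _ hx => by simp [hx]) (by simp)]
    simp [hKm]
  have h1 : ∑ k, v k * K m k = ∑ k, K m k * v k := Finset.sum_congr rfl fun k _ => mul_comm _ _
  have h2 : ∑ j, v j * K j m = ∑ k, K m k * v k := Finset.sum_congr rfl fun k _ => by rw [hK]; ring
  rw [h3, h1, h2]
  ring

/-- **The exponential (Laplace / Ornstein–Uhlenbeck) kernel is positive definite**: for `c ≥ 0`,
every finite matrix `(e^{-c|x_j - x_k|})_{j,k}`, `x_j ∈ ℝ`, is positive semidefinite. Proof by
induction on the number of points, peeling a maximal point (see the module docstring).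
[cite: BergChristensenRessel1984, Ch. 3 §2 (PDF p. 75)] -/
theorem isPosDefKernel_exp_neg_mul_abs_sub {c : ℝ} (hc : 0 ≤ c) :
    IsPosDefKernel fun x y : ℝ => Real.exp (-(c * |x - y|)) := by
  refine ⟨fun x y => by dsimp only; rw [abs_sub_comm], fun n => ?_⟩
  induction n with
  | zero => intro x v; simp
  | succ n ih =>
    intro x v
    -- a maximal point `x j₀`
    obtain ⟨j₀, -, hj₀⟩ := Finset.exists_max_image Finset.univ x ⟨0, Finset.mem_univ _⟩
    set s := j₀.succAbove with hs
    set x' : Fin n → ℝ := x ∘ s with hx'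
    set v' : Fin n → ℝ := v ∘ s with hv'
    set E : ℝ → ℝ → ℝ := fun a b => Real.exp (-(c * |a - b|)) with hE
    have hEsymm : ∀ a b, E a b = E b a := fun a b => by simp only [hE, abs_sub_comm]
    have hEdiag : ∀ a, E a a = 1 := fun a => by simp [hE]
    have hEle : ∀ a b, E a b ≤ 1 := fun a b => by
      simp only [hE]
      rw [Real.exp_le_one_iff, neg_nonpos]
      positivity
    have hEpos : ∀ a b, 0 < E a b := fun a b => Real.exp_pos _
    -- split the quadratic form at `j₀`
    have hsplit : ∑ j, ∑ k, v j * v k * E (x j) (x k) =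
        v j₀ ^ 2 + 2 * v j₀ * ∑ k, E (x j₀) (x' k) * v' k + ∑ j, ∑ k, v' j * v' k * E (x' j) (x' k) := by
      rw [Fin.sum_univ_succAbove _ j₀]
      simp_rw [Fin.sum_univ_succAbove _ j₀]
      simp only [hx', hv', Function.comp_apply, hEdiag, mul_one, Finset.sum_add_distrib]
      have e1 : ∑ j : Fin n, v (j₀.succAbove j) * v j₀ * E (x (j₀.succAbove j)) (x j₀) =
          v j₀ * ∑ k : Fin n, E (x j₀) (x (j₀.succAbove k)) * v (j₀.succAbove k) := by
        rw [Finset.mul_sum]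
        refine Finset.sum_congr rfl fun j _ => ?_
        rw [hEsymm]; ring
      have e2 : ∑ k : Fin n, v j₀ * v (j₀.succAbove k) * E (x j₀) (x (j₀.succAbove k)) =
          v j₀ * ∑ k : Fin n, E (x j₀) (x (j₀.succAbove k)) * v (j₀.succAbove k) := by
        rw [Finset.mul_sum]
        refine Finset.sum_congr rfl fun j _ => ?_
        ring
      rw [e1, e2, hs]
      ring
    rw [hsplit]
    have hQ' : 0 ≤ ∑ j, ∑ k, v' j * v' k * E (x' j) (x' k) := ih x' v'
    rcases Nat.eq_zero_or_pos n with hn | hn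
    · subst hn
      simp only [Finset.univ_eq_empty, Finset.sum_empty, mul_zero, add_zero]
      positivity
    · haveI : Nonempty (Fin n) := Fin.pos_iff_nonempty.mp hn
      -- a maximal point `x' m` among the remaining ones
      obtain ⟨m, -, hm⟩ := Finset.exists_max_image Finset.univ x' Finset.univ_nonempty
      have hx0m : x' m ≤ x j₀ := hj₀ (s m) (Finset.mem_univ _)
      set ρ : ℝ := E (x j₀) (x' m) with hρ
      have hρ1 : ρ ≤ 1 := hEle _ _
      have hρ0 : 0 ≤ ρ := (hEpos _ _).le
      -- the new row is `ρ` times the row of `m`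
      have hrow : ∀ k, E (x j₀) (x' k) = ρ * E (x' m) (x' k) := by
        intro k
        have hkm : x' k ≤ x' m := hm k (Finset.mem_univ _)
        simp only [hρ, hE]
        rw [← Real.exp_add, abs_of_nonneg (by linarith), abs_of_nonneg (by linarith),
          abs_of_nonneg (by linarith)]
        ring_nf
      set W : ℝ := ∑ k, E (x' m) (x' k) * v' k with hW
      have hcross : ∑ k, E (x j₀) (x' k) * v' k = ρ * W := by
        rw [hW, Finset.mul_sum]
        refine Finset.sum_congr rfl fun k _ => ?_
        rw [hrow]; ring
      -- Cauchy–Schwarz from the induction hypothesis: `W² ≤ Q'(v')`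
      have hCS : W ^ 2 ≤ ∑ j, ∑ k, v' j * v' k * E (x' j) (x' k) := by
        have h := ih x' (fun j => v' j + if j = m then -W else 0)
        rw [sum_sum_mul_mul_add_single (fun j k => E (x' j) (x' k)) (fun j k => hEsymm _ _) m
          (hEdiag _) v' (-W)] at h
        rw [← hW] at h
        nlinarith [h]
      rw [hcross]
      nlinarith [hCS, hQ', sq_nonneg (W + ρ * v j₀), mul_nonneg (sq_nonneg (v j₀)) (sub_nonneg.2 hρ1),
        hρ0]

/-- **Unit Gram vectors for a normalised positive definite kernel.** If `φ` is positive definite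
with `φ(x, x) = 1`, then on every finite family `x : ι → X` there are vectors `X_a ∈ ℂ^ι` with
`Σ_r conj(X_a r) · X_b r = φ(x_a, x_b)` and `Σ_r ‖X_a r‖² = 1` — the columns of the positive
square root of the (real, positive semidefinite) matrix `(φ(x_a, x_b))`.
[cite: BergChristensenRessel1984, Ch. 3 §1.2 (PDF p. 69)] -/
theorem IsPosDefKernel.exists_gram_vectors {φ : X → X → ℝ} (h : IsPosDefKernel φ)
    (hdiag : ∀ y, φ y y = 1) {ι : Type*} [Fintype ι] [DecidableEq ι] (x : ι → X) :
    ∃ V : ι → ι → ℂ, (∀ a b, ∑ r, star (V a r) * V b r = (φ (x a) (x b) : ℂ)) ∧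
      ∀ a, ∑ r, ‖V a r‖ ^ 2 = 1 := by
  set K : Matrix ι ι ℝ := Matrix.of fun j k : ι => φ (x j) (x k) with hK
  have hKpsd : K.PosSemidef := h.posSemidef_matrix_of_fintype x
  have hK0 : 0 ≤ K := Matrix.nonneg_iff_posSemidef.mpr hKpsd
  set B : Matrix ι ι ℝ := CFC.sqrt K with hB
  have hBB : B * B = K := CFC.sqrt_mul_sqrt_self K hK0
  have hBsa : star B = B := (CFC.sqrt_nonneg K).isSelfAdjoint.star_eq
  have hBsymm : ∀ r a, B r a = B a r := by
    intro r a
    have := congrFun (congrFun hBsa r) a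
    rw [Matrix.star_apply, star_trivial] at this
    exact this.symm
  refine ⟨fun a r => ((B r a : ℝ) : ℂ), fun a b => ?_, fun a => ?_⟩
  · have hab : K a b = ∑ r, B a r * B r b := by
      rw [← hBB, Matrix.mul_apply]
    have : (φ (x a) (x b) : ℂ) = ((K a b : ℝ) : ℂ) := by simp [hK]
    rw [this, hab]
    push_cast
    refine Finset.sum_congr rfl fun r _ => ?_
    rw [Complex.star_def, Complex.conj_ofReal, hBsymm r a]
  · have haa : K a a = ∑ r, B a r * B r a := by
      rw [← hBB, Matrix.mul_apply]
    have h1 : K a a = 1 := by simp [hK, hdiag]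
    simp only [Complex.norm_real, Real.norm_eq_abs, sq_abs]
    rw [← h1, haa]
    refine Finset.sum_congr rfl fun r _ => ?_
    rw [hBsymm r a, sq]

end Literature.Analysis.Matrix
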